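import Summits.QuantumFields.BalabanUV.Beta.D1BFx.RoadEndBFxRecut

/-!
# Road BF-x, A7 END WITH THE COARSEST HONEST REST HYPOTHESIS: MAIN + corner + «the TOTAL off-corner rest of the explicit one-loop expression has
# an n-uniformly bounded base-point-averaged second moment» — immune to any further mis-cut of the word table

Owner file of road «BF-x» (BINDER-OWNERS row D1, co-owner d1-p2, gen 3).  `AssemblyEndRecut.defect_le_at_recut` (p224097) displays ONE n-uniform bound
PER re-cut word.  The lesson of FINDING «LON-MISCUT» (journal 2026-08-20 15:31:53Z) is that per-word hypotheses are only as good as the cut; the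
weakest hypothesis of this shape — and the one the road actually needs — is a bound on the SUM of all non-main words.  This file re-indexes the
REST slot of `Assembly.abs_defect_le_of_slots` by `Fin 2`: word `0` = the corner word (kept apart: it is a THEOREM at the pinned normalisation,
`RoadEndBFxRecut.rest_all_of_offCorner`), word `1` = THE SUM OF ALL OTHER RE-CUT WORDS `Σ_{τ ≠ cornerIdx} restK' … τ`.  Per-word or per-class
bounds (the claimable leaves tad ∕ bub′ ∕ gtad ∕ gbub ∕ crossE′) FEED this hypothesis by `Assembly.fullSum_finset_sum` + the triangle inequality;
cancellations ACROSS words are now admissible.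

`defect_le_at_total`: displayed — (K) `hK`+`hω`+`hlam`; `Spr (Ga n a)`; the slot-table sockets; `hdiv`; `hrowgh`; the profile's bound and evenness;
the corner word's bound `hRest₀` and THE TOTAL OFF-CORNER BOUND `hRest₁`; (U).  (F), (CONV) (fine pieces AND both rest classes) and (SPLIT) discharged.
HONEST STATUS: assembly [folklore]; no cited facts; D1 NOT discharged.  HONEST DEPENDENCY: continuum YM on T⁴ ⇐ BetaPertH ∧ nine spine estimates
(0/9 proved); BetaPertH ⇐ (D1) ∧ (D4) ∧ CAP+tail; G-an2-4 gates asym, D1 and NE2/3/4.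
-/

noncomputable section

open Finset Filter Topology
open scoped BigOperators
open Literature.MathematicalPhysics.QuantumFieldTheory.Balaban1983to89
open Literature.MathematicalPhysics.QuantumFieldTheory.Balaban1983to89.Beta
open WindowIdentification (fullSum psum)
open B12Sec2to5 (l1)
open DyadicShell (Pt toReal)
open ExpKernelCalculus (Site MKer BiLoc shiftK)
open SquareTable (stK)
open DressedMomentNormalisation (resSite)
open Summit.QuantumFields.BalabanUV.Beta.TameKernelCalculus (Spr Loc)
open Summit.QuantumFields.BalabanUV.Beta.D1BFx.MomentTransferPeriodic (baseKer)
open Summit.QuantumFields.BalabanUV.Beta.D1BFx.GluonLeg (Ga)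
open Summit.QuantumFields.BalabanUV.Beta.D1BFx.ReducedKernel (TableR TOfRed)
open Summit.QuantumFields.BalabanUV.Beta.D1BFx.DressedTadpoleTable (tableRed)
open Summit.QuantumFields.BalabanUV.Beta.D1BFx.ReducedKernelSandwich (fineHess)
open Summit.QuantumFields.BalabanUV.Beta.D1BFx.FineStencilBFBalaban (SbfBal)
open Summit.QuantumFields.BalabanUV.Beta.D1BFx.SecondStencilBF (Wbf)
open Summit.QuantumFields.BalabanUV.Beta.D1BFx.GhostKernelComplete (PghQ fineHessGhQ)
open Summit.QuantumFields.BalabanUV.Beta.D1BFx.SplitInstance (RestIdx)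
open Summit.QuantumFields.BalabanUV.Beta.D1BFx.Assembly (abs_defect_le_of_slots exists_tendsto_psum_finset_sum)
open Summit.QuantumFields.BalabanUV.Beta.D1BFx.AssemblySlots (conv_PghQ hF_PghQ_of_wardRows)
open Summit.QuantumFields.BalabanUV.Beta.D1BFx.AssemblySlotsBal (conv_SbfBal)
open Summit.QuantumFields.BalabanUV.Beta.D1BFx.FineHessianWardKroneckerBlock (hF_SbfBal_of_divFree)
open Summit.QuantumFields.BalabanUV.Beta.D1BFx.SplitRecut (restK' split_at_basePoint_recut)
open Summit.QuantumFields.BalabanUV.Beta.D1BFx.RoadEndBFxRecut (cornerIdx)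
open Summit.QuantumFields.BalabanUV.Beta.D1BFx.AssemblyEndRecut (hKr_recut)

namespace Summit.QuantumFields.BalabanUV.Beta.D1BFx.AssemblyEndTotal

/-! ## §1 The road's defect bound at one block size, TOTAL off-corner rest -/

section At

variable (n : ℕ) [NeZero n] (a cE cVH cΛ cR cK cQ cE₂ cJ4 cΛ₂ cR₂ cQ₂ x₀ ωgl ωgh lam N : ℝ) {WE WJ WΛ WR WQ : TableR}
  {CE CJ CΛ CRt CQ δW : ℝ} {gp : Pt → Pt → ℝ} {μ ν : Fin 4} {υ : Type*} [Fintype υ] {c : ℝ} {Ru CU : υ → ℝ} {CR₀ CR₁ : ℝ}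

/-- [folklore] **ROAD BF-x AT BLOCK SIZE `n` (`2 ≤ n`, `Odd n`), TOTAL REST FORM:
`|c − Σ_{b ∈ image resSite} n⁻⁴·fullSum (stK μ ν N (gp b))| ≤ Σ_u CU u + (CR₀ + CR₁)`** from (K), the leg binder, the slot-table sockets, `hdiv`, the ghost Ward
rows, the profile's bound and evenness, (U), the corner word's bound `CR₀` and ONE bound `CR₁` on the base-point average of the full sum of THE SUM OF ALL OTHER
RE-CUT WORDS — slots (F), (CONV) and (SPLIT) DISCHARGED. -/
theorem defect_le_at_total (hn : 2 ≤ n) (hodd : Odd n) (ha : 0 < a) (hμν : μ ≠ ν) (hGa : Spr (Ga n a))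
    (hK : c = ωgl * B12Beta.secondMoment (TOfRed n a (SbfBal n a cE cVH cΛ cR cK cQ)
        (tableRed n (Wbf cE₂ cJ4 cΛ₂ cR₂ cQ₂ WE WJ WΛ WR WQ))) μ ν
      + ωgh * B12Beta.secondMoment (PghQ n a x₀ cK cQ) μ ν + ∑ u, Ru u)
    (hω : ωgh * cK ^ 2 = -2 * (ωgl * cE ^ 2)) (hlam : ωgl * cE ^ 2 = 2 * N ^ 2 * lam)
    (hδW : 0 < δW)
    (hE : ∀ κ u l u', BiLoc (WE κ u l u') u u' CE δW) (hJ : ∀ κ u l u', BiLoc (WJ κ u l u') u u' CJ δW)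
    (hΛ : ∀ κ u l u', BiLoc (WΛ κ u l u') u u' CΛ δW) (hR : ∀ κ u l u', BiLoc (WR κ u l u') u u' CRt δW)
    (hQ : ∀ κ u l u', BiLoc (WQ κ u l u') u u' CQ δW)
    (hEc : ∀ (κ : Fin 4) (u : Site 4) (l : Fin 4) (u' t : Site 4), WE κ (u + (n : ℤ) • t) l (u' + (n : ℤ) • t) = shiftK (-((n : ℤ) • t)) (WE κ u l u'))
    (hJc : ∀ (κ : Fin 4) (u : Site 4) (l : Fin 4) (u' t : Site 4), WJ κ (u + (n : ℤ) • t) l (u' + (n : ℤ) • t) = shiftK (-((n : ℤ) • t)) (WJ κ u l u'))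
    (hΛc : ∀ (κ : Fin 4) (u : Site 4) (l : Fin 4) (u' t : Site 4), WΛ κ (u + (n : ℤ) • t) l (u' + (n : ℤ) • t) = shiftK (-((n : ℤ) • t)) (WΛ κ u l u'))
    (hRc : ∀ (κ : Fin 4) (u : Site 4) (l : Fin 4) (u' t : Site 4), WR κ (u + (n : ℤ) • t) l (u' + (n : ℤ) • t) = shiftK (-((n : ℤ) • t)) (WR κ u l u'))
    (hQc : ∀ (κ : Fin 4) (u : Site 4) (l : Fin 4) (u' t : Site 4), WQ κ (u + (n : ℤ) • t) l (u' + (n : ℤ) • t) = shiftK (-((n : ℤ) • t)) (WQ κ u l u'))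
    (hEs : ∀ κ u l u', WE κ u l u' = WE l u' κ u) (hJs : ∀ κ u l u', WJ κ u l u' = WJ l u' κ u) (hΛs : ∀ κ u l u', WΛ κ u l u' = WΛ l u' κ u)
    (hRs : ∀ κ u l u', WR κ u l u' = WR l u' κ u) (hQs : ∀ κ u l u', WQ κ u l u' = WQ l u' κ u)
    (hdiv : ∀ (l' : Fin 4) (u' u : Site 4), ∑ κ' : Fin 4,
      (fineHess n a (SbfBal n a cE cVH cΛ cR cK cQ) (Wbf cE₂ cJ4 cΛ₂ cR₂ cQ₂ WE WJ WΛ WR WQ) κ' l' (u - Pi.single κ' 1) u'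
        - fineHess n a (SbfBal n a cE cVH cΛ cR cK cQ) (Wbf cE₂ cJ4 cΛ₂ cR₂ cQ₂ WE WJ WΛ WR WQ) κ' l' u u') = 0)
    (hrowgh : ∀ (κ' l' : Fin 4) (b : Site 4), HasSum (fineHessGhQ n a x₀ cK cQ κ' l' b) 0)
    (hg : ∀ b : Pt, ∃ C δ : ℝ, 0 < δ ∧ ∀ v, |gp b v| ≤ C * Real.exp (-δ * l1 v)) (hgev : ∀ b w : Pt, gp b (-w) = gp b w)
    (hRest₀ : |∑ b ∈ (univ : Finset (Fin 4 → Fin n)).image resSite, ((n : ℝ) ^ 4)⁻¹ * fullSum (fun w : Pt =>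
      restK' n a (gp b) cE cΛ cR cK cQ cE₂ cJ4 cΛ₂ cR₂ cQ₂ x₀ WE WJ WΛ WR WQ ωgl ωgh lam N μ ν b cornerIdx w)| ≤ CR₀)
    (hRest₁ : |∑ b ∈ (univ : Finset (Fin 4 → Fin n)).image resSite, ((n : ℝ) ^ 4)⁻¹ * fullSum (fun w : Pt =>
      ∑ τ ∈ (univ : Finset RestIdx).erase cornerIdx,
        restK' n a (gp b) cE cΛ cR cK cQ cE₂ cJ4 cΛ₂ cR₂ cQ₂ x₀ WE WJ WΛ WR WQ ωgl ωgh lam N μ ν b τ w)| ≤ CR₁)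
    (hU : ∀ u, |Ru u| ≤ CU u) :
    |c - ∑ b ∈ (univ : Finset (Fin 4 → Fin n)).image resSite, ((n : ℝ) ^ 4)⁻¹ * fullSum (stK μ ν N (gp b))|
      ≤ (∑ u, CU u) + (CR₀ + CR₁) := by
  have h1 : 1 ≤ n := le_trans one_le_two hn
  have hEl : ∀ κ u l u', Loc (WE κ u l u') := fun κ u l u' => ⟨u, u', CE, δW, hδW, hE κ u l u'⟩
  have hJl : ∀ κ u l u', Loc (WJ κ u l u') := fun κ u l u' => ⟨u, u', CJ, δW, hδW, hJ κ u l u'⟩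
  have hΛl : ∀ κ u l u', Loc (WΛ κ u l u') := fun κ u l u' => ⟨u, u', CΛ, δW, hδW, hΛ κ u l u'⟩
  have hRl : ∀ κ u l u', Loc (WR κ u l u') := fun κ u l u' => ⟨u, u', CRt, δW, hδW, hR κ u l u'⟩
  have hQl : ∀ κ u l u', Loc (WQ κ u l u') := fun κ u l u' => ⟨u, u', CQ, δW, hδW, hQ κ u l u'⟩
  have hCR : (CR₀ + CR₁) = ∑ k : Fin 2, (if k = 0 then CR₀ else CR₁) := by rw [Fin.sum_univ_two]; simp
  rw [hCR]
  refine abs_defect_le_of_slots (ι := Fin 2) (T := Fin 2) (υ := υ) (μ := μ) (ν := ν) (N := N) (CU := CU) (CR := fun k => if k = 0 then CR₀ else CR₁)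
    (c := fun _ => c) (Bset := fun _ => (univ : Finset (Fin 4 → Fin n)).image resSite) (wt := fun _ _ => ((n : ℝ) ^ 4)⁻¹)
    (Gf := fun _ => gp)
    (P := fun i _ => if i = 0 then TOfRed n a (SbfBal n a cE cVH cΛ cR cK cQ) (tableRed n (Wbf cE₂ cJ4 cΛ₂ cR₂ cQ₂ WE WJ WΛ WR WQ))
      else PghQ n a x₀ cK cQ)
    (ω := fun i _ => if i = 0 then ωgl else ωgh) (R := fun u _ => Ru u)
    (Kf := fun i _ b w => if i = 0 then ((n : ℝ) ^ 8)⁻¹ * (toReal w μ * toReal w ν *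
        baseKer (fineHess n a (SbfBal n a cE cVH cΛ cR cK cQ) (Wbf cE₂ cJ4 cΛ₂ cR₂ cQ₂ WE WJ WΛ WR WQ) μ ν) b w)
      else ((n : ℝ) ^ 8)⁻¹ * (toReal w μ * toReal w ν * baseKer (fineHessGhQ n a x₀ cK cQ μ ν) b w))
    (Kr := fun k _ b w => if k = 0 then restK' n a (gp b) cE cΛ cR cK cQ cE₂ cJ4 cΛ₂ cR₂ cQ₂ x₀ WE WJ WΛ WR WQ ωgl ωgh lam N μ ν b cornerIdx w
      else ∑ τ ∈ (univ : Finset RestIdx).erase cornerIdx, restK' n a (gp b) cE cΛ cR cK cQ cE₂ cJ4 cΛ₂ cR₂ cQ₂ x₀ WE WJ WΛ WR WQ ωgl ωgh lam N μ ν b τ w)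
    ?_ ?_ ?_ ?_ ?_ ?_ ?_ n hn
  · -- (K)
    intro _ _
    rw [Fin.sum_univ_two]
    simp only [Fin.isValue, if_true, one_ne_zero, if_false]
    exact hK
  · -- (F)
    intro i _ _
    fin_cases i
    · simp only [Fin.zero_eta, Fin.isValue, if_true]
      exact hF_SbfBal_of_divFree n a cE cVH cΛ cR cK cQ cE₂ cJ4 cΛ₂ cR₂ cQ₂ h1 ha hGa hδW hE hJ hΛ hR hQ hEc hJc hΛc hRc hQc hEs hJs hΛs
        hRs hQs hdiv μ ν
    · simp only [Fin.mk_one, Fin.isValue, one_ne_zero, if_false]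
      exact hF_PghQ_of_wardRows n a x₀ cK cQ ha hodd hrowgh μ ν
  · -- (CONV) fine pieces
    intro i _ _
    fin_cases i
    · simp only [Fin.zero_eta, Fin.isValue, if_true]
      exact conv_SbfBal n a cE cVH cΛ cR cK cQ cE₂ cJ4 cΛ₂ cR₂ cQ₂ ha hGa hδW hE hJ hΛ hR hQ μ ν
    · simp only [Fin.mk_one, Fin.isValue, one_ne_zero, if_false]
      exact conv_PghQ n a x₀ cK cQ ha μ ν
  · -- (CONV) for the corner word and for the SUM of all other words — PROVED
    intro k _ _ b hb
    fin_cases k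
    · simp only [Fin.zero_eta, Fin.isValue, if_true]
      exact hKr_recut n a cE cΛ cR cK cQ cE₂ cJ4 cΛ₂ cR₂ cQ₂ x₀ ωgl ωgh lam N ha hGa hg hδW hE hJ hΛ hR hQ hμν cornerIdx b hb
    · simp only [Fin.mk_one, Fin.isValue, one_ne_zero, if_false]
      exact exists_tendsto_psum_finset_sum _ fun τ _ =>
        hKr_recut n a cE cΛ cR cK cQ cE₂ cJ4 cΛ₂ cR₂ cQ₂ x₀ ωgl ωgh lam N ha hGa hg hδW hE hJ hΛ hR hQ hμν τ b hb
  · -- (SPLIT): the re-cut identity, words regrouped as corner + the rest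
    intro _ _ b _ w
    rw [Fin.sum_univ_two, Fin.sum_univ_two]
    simp only [Fin.isValue, if_true, one_ne_zero, if_false]
    obtain ⟨C, δ, hδ, hgb⟩ := hg b
    rw [split_at_basePoint_recut n a cE cVH cΛ cR cK cQ cE₂ cJ4 cΛ₂ cR₂ cQ₂ x₀ WE WJ WΛ WR WQ ωgl ωgh lam N μ ν ha hGa hδ hgb (hgev b) hEl hJl
      hΛl hRl hQl hμν hω hlam b w, ← Finset.add_sum_erase _ _ (mem_univ cornerIdx)]
  · -- (U)
    intro u _ _
    exact hU u
  · -- (REST): corner + total off-corner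
    intro k _ _
    fin_cases k
    · simp only [Fin.zero_eta, Fin.isValue, if_true]
      exact hRest₀
    · simp only [Fin.mk_one, Fin.isValue, one_ne_zero, if_false]
      exact hRest₁

end At

end Summit.QuantumFields.BalabanUV.Beta.D1BFx.AssemblyEndTotal

end
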